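import Literature.MathematicalPhysics.QuantumFieldTheory.Balaban1983to89.B6BlockDecayGDivFactorsV1

/-!
# `Balaban1983to89.B6Prop25GDivDecayTwoScaleV1` — T. Bałaban, *Propagators and renormalization transformations for lattice gauge theories. II*,
# Commun. Math. Phys. **96** (1984) 223–250 [Balaban1984PropagatorsII], PROPOSITION 2.5 p. 246, THE MEMBER `|(G∇*J)(x)|` OF (1.110) FOR THE
# GENUINE TWO-SCALE `G = Δ_a⁻¹` OF (2.90), `Λ′ ⊂ T^{(j+1)}` ARBITRARY, for `tsV1` at the paper's scaling — file 14, the assembly of the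
# divergence member of the two-level decay programme

statement-level skeleton of published theorems with citation tags; proofs where landed; nothing here is a claim about the Yang–Mills mass gap

p. 246 (Proposition 2.5, verbatim): *"The operator G_□ defined by (2.90) … has the representation (2.129) and satisfies all the inequalities
(1.110)–(1.114) of the Proposition 1.2 with a positive constant δ₂ instead of δ₀. This constant depends on d and L only."*  [4] (1.110) p. 35:
*"|(GJ)(x)|, |(∇GJ)(x)|, |(G∇*J)(x)|, |(ΔGJ)(x)| ≤ O(1)e^{−δ₀|y−y′|}|J| for x ∈ Δ̃(y), supp J ⊂ Δ̃(y′)"*; (2.131) p. 246: *"G̃_j = G_j −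
G_jQ_j*(Q_jG_jQ_j*)⁻¹Q_jG_j"*.

WHAT THIS FILE DOES.  Composing the operator identity (2.129) (file 1's `G_eq_op_V1`) on the right with the backward difference `∇_λ* = n(S_λ⁻¹ − I)`
(file 12; `∇_λ*` is the `ℓ²`-adjoint of `∇_λ`): `G∇_λ* = K₁∇_λ* + (I − K₂)*[(G̃_j∇_λ* + H_jC̃H_j*∇_λ*) − (G̃_j + H_jC̃H_j*)(K₂∇_λ*)]`, every
right-differentiated last factor having a uniform block bound — §1 **`blockBound_GtDadj_scaling`** (`G̃_j∇_λ* = (I − H_jQ_j)(G^{(n^{d+1})}∇_λ*)` by file 6's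
`Gt_eq_comp_GE`, with [4] Prop. 1.2's member `G∇*J` for `G_k` = file 12's `blockBound_GEDadj_scaling`, file 6's `blockBound_Qv`, file 3's
`blockBound_Hj`), file 13 (`K₁∇_λ*`, `K₂∇_λ*`, `H_jC̃(∇_λH_j)*`) — and every undifferentiated factor too (files 3, 5, 6), file 2's block calculus gives
§2 **`blockBound_GDadj_scaling`**: for every `d + 1`, `L`, `0 < a₀ ≤ a₁` there are `δ₂ > 0`, `C ≥ 0` such that for every volume, `j + 1 ≤ m + K`, `Λ′`,
weights `a₀n^{d+1} ≤ w ≤ a₁n^{d+1}`, direction `λ`, fine bond `b₀`, unit site `y`: `Σ_{b₀′ : y(b₀′₋) = y}|(G∇_λ*)(e_{b₀′})_{b₀}| ≤ C·e^{−δ₂|y(b₀₋) − y|_T}`;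
and §3 THE PRINTED SHAPE **`prop25_ineq110_Gdiv`**: `|(G∇_λ*J)(b₀)| ≤ C·e^{(1+2δ₂)r}·e^{−δ₂|y − y′|_T}·|J|`, `(∇_λ*J)(b) = n(J(b − e_λ) − J(b))`, for `J`
supported on the fine bonds over the unit sites within `r` of `y′` and `b₀` over those within `r` of `y` (file 2's `abs_apply_le_of_support`); the
printed `|(G∇*J)(x)|` for a tensor source `J = (J_λ)` is the sum over `λ` of these.

HONEST SCOPE / DIVERGENCES. (1) The members `|GJ|` (file 7), `|∇GJ|` (file 10) and `|G∇*J|` (this file) of (1.110) and `‖ζGJ‖` of (1.114)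
(file 11) are theorems for the two-scale `G`; `ΔGJ`, the remaining members of (1.114) and (1.111)–(1.113) are not treated here. (2) `∇_λ*` = the
`ℓ²`-adjoint of the forward difference with the factor `η⁻¹ = L^j`, componentwise on fine bond fields. (3) `c = L^j`; weights in [4]'s window;
`C, δ₂` depend on `d, L, a₀, a₁` only. (4) No new definition, no new hypothesis: files 1–13 and [4] Prop. 1.2 (B5's family, p19) BY NAME.  NOT
summit progress.  Unit `lit-balaban-p22` (gen 15), 2026-08-22.
-/

noncomputable section

open scoped InnerProductSpace BigOperators
open Finset

namespace Literature.MathematicalPhysics.QuantumFieldTheory.Balaban1983to89.B6Prop25GDivDecayTwoScaleV1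

open LatticeFieldCalculus B5SectBStatements B5Eq117TorusCarriers B6SectADomainsV1 B6SectAOperatorsV1 B6SectAVectorModelV1 B6SectCOperators
  B6SectCTwoScaleV1 B6SectCTwoScaleV1Lattice B5Eq118OneStroke
open BalabanImbrieJaffe1984to88.BIJ85AxialPropagator411 (BondSpace)
open B4Sect5Torus (IsPseudoDist SumBound)
open B4TorusKernel (periodConst)
open B4TorusKernel.MultiPeriod (torusSupNorm torusSupNorm_nonneg)
open B4Sect5Proof (latticeConst latticeConst_nonneg)
open B5Hk163Decay (MG163 MG163_nonneg)
open B5Hk163Strip (kappa163 kappa163_pos)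
open B5Kernel166Decay (periodConst_pos)
open B6LowerBound2153Torus (rep)
open B6Repr2129Operator (G_eq_op_V1)
open B6BlockDecayCalculus (blockBound_comp blockBound_add blockBound_sub blockBound_id blockBound_mono abs_apply_le_of_support
  torusDist_isPseudoDist torusDist_sumBound)
open B6BlockDecayHjCovV1 (blockBound_Hj blockBound_HjCtHj_scaling)
open B6BlockDecayK12V1 (blockBound_K2adj_scaling)
open B6BlockDecayGtV1 (Gt_eq_comp_GE blockBound_Qv blockBound_Gt_scaling)
open B6BlockDecayGDivBridgeV1 (Dadj_comp_apply blockBound_GEDadj_scaling)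
open B6BlockDecayGDivFactorsV1 (blockBound_K1Dadj_scaling blockBound_K2Dadj_scaling blockBound_HjCtDHjadj_scaling)

variable {d L m K : ℕ} {hd : 1 ≤ d + 1} {hL : Odd L ∧ 1 < L} {j : ℕ}

/-! ## §1  `G̃_j∇_λ*` at the scaling -/

open Classical in
/-- **`G̃_j∇_λ*` HAS AN EXPONENTIALLY DECAYING BLOCK KERNEL, UNIFORMLY** (at `c = L^j`): `δ > 0`, `C ≥ 0` depending on `d, L` only —
`G̃_j∇_λ* = G^{(n^{d+1})}∇_λ* − H_j(Q_j(G^{(n^{d+1})}∇_λ*))` (file 6's `Gt_eq_comp_GE` at `w′ = n^{d+1}`), `G^{(n^{d+1})}∇_λ*` `(O(1), δ₀)` by [4] Prop. 1.2 member `G∇*J`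
(file 12's `blockBound_GEDadj_scaling`), `Q_j` `(e^{κ_H}, κ_H)` (file 6), `H_j` `(A_H(d+1), κ_H)` (file 3).
[cite: Balaban1984PropagatorsII, (2.131) p.246, Prop. 2.5 p.246; Balaban1984PropagatorsI, (1.110) p.35] -/
theorem blockBound_GtDadj_scaling (d L : ℕ) (hd : 1 ≤ d + 1) (hL : Odd L ∧ 1 < L) :
    ∃ δ : ℝ, 0 < δ ∧ ∃ C : ℝ, 0 ≤ C ∧ ∀ (m K : ℕ) (j : ℕ) (hc : ((L : ℝ) ^ j) ≠ 0)
      (_hj : j + 1 ≤ (⟨d + 1, L, m, K, hd, hL⟩ : Params).m + (⟨d + 1, L, m, K, hd, hL⟩ : Params).K)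
      (Λ' : Finset (Site (⟨d + 1, L, m, K, hd, hL⟩ : Params) (j + 1))) (w : CIdx j Λ' → ℝ) (_hw : ∀ i, 0 < w i) (lam : Fin (d + 1))
      (b₀ : PBond (⟨d + 1, L, m, K, hd, hL⟩ : Params) 0) (y : Site (⟨d + 1, L, m, K, hd, hL⟩ : Params) j),
      ∑ b₀' ∈ univ.filter (fun b₀' : PBond (⟨d + 1, L, m, K, hd, hL⟩ : Params) 0 => iterBlockOf j b₀'.src = y),
          |((tsV1 hc Λ' w).Gt ∘ₗ ((((L : ℝ) ^ j) • (onE (LinearMap.funLeft ℝ ℝ (fun b : PBond (⟨d + 1, L, m, K, hd, hL⟩ : Params) 0 => (⟨b.src.unshift lam, b.dir⟩ : PBond (⟨d + 1, L, m, K, hd, hL⟩ : Params) 0))) - LinearMap.id) : BondSpace (⟨d + 1, L, m, K, hd, hL⟩ : Params) →ₗ[ℝ] BondSpace (⟨d + 1, L, m, K, hd, hL⟩ : Params)))) (EuclideanSpace.single b₀' (1 : ℝ)) b₀| ≤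
        C * Real.exp (-(δ * torusSupNorm (Mk (⟨d + 1, L, m, K, hd, hL⟩ : Params) j)
            (rep (Mk (⟨d + 1, L, m, K, hd, hL⟩ : Params) j) (iterBlockOf j b₀.src) - rep (Mk (⟨d + 1, L, m, K, hd, hL⟩ : Params) j) y))) := by
  obtain ⟨δD, hδD, CD, hCD, hDG⟩ := blockBound_GEDadj_scaling d L hd hL one_pos
  -- rates: `Q_j ∘ (G∇*)` at `δ₁ = min(δ_D, κ_H/2)`, `H_j ∘ (Q_jG∇*)` at `δ₂ = δ₁/2`, the difference at `δ₂`
  set κH : ℝ := kappa163 (d + 1) / ((d : ℝ) + 1) with hκH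
  have hκH0 : 0 < κH := div_pos (kappa163_pos _) (by positivity)
  set δ₁ : ℝ := min δD (κH / 2) with hδ₁
  have hδ₁0 : 0 < δ₁ := lt_min hδD (half_pos hκH0)
  have hδ₁D : δ₁ ≤ δD := min_le_left _ _
  have hδ₁H : δ₁ < κH := lt_of_le_of_lt (min_le_right _ _) (half_lt_self hκH0)
  set δ₂ : ℝ := δ₁ / 2 with hδ₂
  have hδ₂0 : 0 < δ₂ := half_pos hδ₁0
  have hδ₂₁ : δ₂ ≤ δ₁ := half_le_self hδ₁0.le
  have hδ₂H : δ₂ < κH := by linarith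
  have hδ₂D : δ₂ ≤ δD := hδ₂₁.trans hδ₁D
  set AH : ℝ := MG163 (d + 1) * periodConst (kappa163 (d + 1)) d * ((1 * (d + 1) : ℕ) : ℝ) with hAH
  have hAH0 : 0 ≤ AH := mul_nonneg (mul_nonneg (MG163_nonneg _) (periodConst_pos (kappa163_pos _) _).le) (Nat.cast_nonneg _)
  set K₁ : ℝ := latticeConst (d + 1) (κH - δ₁) with hK₁
  set K₂ : ℝ := latticeConst (d + 1) (κH - δ₂) with hK₂
  have hK₁0 : 0 ≤ K₁ := latticeConst_nonneg _ (by linarith)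
  have hK₂0 : 0 ≤ K₂ := latticeConst_nonneg _ (by linarith)
  have hL0 : 0 < L := by have := hL.2; omega
  haveI : NeZero L := ⟨by omega⟩
  have hLp : (0 : ℝ) < L := by exact_mod_cast hL0
  set C : ℝ := CD + AH * (Real.exp κH * CD * K₁) * K₂ with hC
  have hC0 : 0 ≤ C := by positivity
  refine ⟨δ₂, hδ₂0, C, hC0, ?_⟩
  intro m K j hc hj Λ' w hw lam b₀ y
  have hj' : j ≤ m + K := Nat.le_of_succ_le hj
  have hLj : (0 : ℝ) < (L : ℝ) ^ j := by positivity
  have hw' : (0 : ℝ) < 1 * ((L : ℝ) ^ j) ^ (d + 1) := by positivity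
  have hρ : IsPseudoDist (fun t t' : Site (⟨d + 1, L, m, K, hd, hL⟩ : Params) j => torusSupNorm (Mk (⟨d + 1, L, m, K, hd, hL⟩ : Params) j) (rep (Mk (⟨d + 1, L, m, K, hd, hL⟩ : Params) j) t - rep (Mk (⟨d + 1, L, m, K, hd, hL⟩ : Params) j) t')) :=
    torusDist_isPseudoDist (Mk (⟨d + 1, L, m, K, hd, hL⟩ : Params) j)
  have hK : SumBound (fun t t' : Site (⟨d + 1, L, m, K, hd, hL⟩ : Params) j => torusSupNorm (Mk (⟨d + 1, L, m, K, hd, hL⟩ : Params) j) (rep (Mk (⟨d + 1, L, m, K, hd, hL⟩ : Params) j) t - rep (Mk (⟨d + 1, L, m, K, hd, hL⟩ : Params) j) t')) (fun a => latticeConst (d + 1) a) :=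
    torusDist_sumBound (Mk (⟨d + 1, L, m, K, hd, hL⟩ : Params) j)
  have hDGb := hDG m K j hj' hc hw' lam
  have hQ := blockBound_Qv hc hj' Λ' w hκH0.le
  have hH := blockBound_Hj hc hj Λ' hw
  -- `Q_j ∘ (G∇*)` at rate `δ₁`
  have h1 := blockBound_comp hρ hK (tsV1 hc Λ' w).Qv (GE (Domains.whole (P := (⟨d + 1, L, m, K, hd, hL⟩ : Params)) j hj') hc (w := fun _ => 1 * ((L : ℝ) ^ j) ^ (d + 1)) (fun _ => hw') ∘ₗ ((((L : ℝ) ^ j) • (onE (LinearMap.funLeft ℝ ℝ (fun b : PBond (⟨d + 1, L, m, K, hd, hL⟩ : Params) 0 => (⟨b.src.unshift lam, b.dir⟩ : PBond (⟨d + 1, L, m, K, hd, hL⟩ : Params) 0))) - LinearMap.id) : BondSpace (⟨d + 1, L, m, K, hd, hL⟩ : Params) →ₗ[ℝ] BondSpace (⟨d + 1, L, m, K, hd, hL⟩ : Params))))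
    (fun b : PBond (⟨d + 1, L, m, K, hd, hL⟩ : Params) j => b.src) (fun b₀ : PBond (⟨d + 1, L, m, K, hd, hL⟩ : Params) 0 => iterBlockOf j b₀.src) (fun b₀ : PBond (⟨d + 1, L, m, K, hd, hL⟩ : Params) 0 => iterBlockOf j b₀.src)
    (Cf := Real.exp κH) (Cg := CD) (by positivity) hCD hδ₁0.le hδ₁D hδ₁H hQ hDGb
  -- `H_j ∘ (Q_jG∇*)` at rate `δ₂`
  have h2 := blockBound_comp hρ hK (tsV1 hc Λ' w).Hj ((tsV1 hc Λ' w).Qv ∘ₗ (GE (Domains.whole (P := (⟨d + 1, L, m, K, hd, hL⟩ : Params)) j hj') hc (w := fun _ => 1 * ((L : ℝ) ^ j) ^ (d + 1)) (fun _ => hw') ∘ₗ ((((L : ℝ) ^ j) • (onE (LinearMap.funLeft ℝ ℝ (fun b : PBond (⟨d + 1, L, m, K, hd, hL⟩ : Params) 0 => (⟨b.src.unshift lam, b.dir⟩ : PBond (⟨d + 1, L, m, K, hd, hL⟩ : Params) 0))) - LinearMap.id) : BondSpace (⟨d + 1, L, m, K, hd, hL⟩ : Params) →ₗ[ℝ]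 BondSpace (⟨d + 1, L, m, K, hd, hL⟩ : Params)))))
    (fun b₀ : PBond (⟨d + 1, L, m, K, hd, hL⟩ : Params) 0 => iterBlockOf j b₀.src) (fun b : PBond (⟨d + 1, L, m, K, hd, hL⟩ : Params) j => b.src) (fun b₀ : PBond (⟨d + 1, L, m, K, hd, hL⟩ : Params) 0 => iterBlockOf j b₀.src)
    (Cf := AH) (Cg := Real.exp κH * CD * K₁) hAH0 (by positivity) hδ₂0.le hδ₂₁ hδ₂H hH h1
  -- both at rate `δ₂`
  have h3 := blockBound_mono hρ (GE (Domains.whole (P := (⟨d + 1, L, m, K, hd, hL⟩ : Params)) j hj') hc (w := fun _ => 1 * ((L : ℝ) ^ j) ^ (d + 1)) (fun _ => hw') ∘ₗ ((((L : ℝ) ^ j) • (onE (LinearMap.funLeft ℝ ℝ (fun b : PBond (⟨d + 1, L, m, K, hd, hL⟩ : Params) 0 => (⟨b.src.unshift lam, b.dir⟩ : PBond (⟨d + 1, L, m, K, hd, hL⟩ : Params) 0))) - LinearMap.id) : BondSpace (⟨d + 1, L, m, K, hd, hL⟩ : Params) →ₗ[ℝ] BondSpace (⟨d + 1, L, m,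 K, hd, hL⟩ : Params))))
    (fun b₀ : PBond (⟨d + 1, L, m, K, hd, hL⟩ : Params) 0 => iterBlockOf j b₀.src) (fun b₀ : PBond (⟨d + 1, L, m, K, hd, hL⟩ : Params) 0 => iterBlockOf j b₀.src) hCD le_rfl hδ₂D hDGb
  have h4 := blockBound_mono hρ ((tsV1 hc Λ' w).Hj ∘ₗ ((tsV1 hc Λ' w).Qv ∘ₗ (GE (Domains.whole (P := (⟨d + 1, L, m, K, hd, hL⟩ : Params)) j hj') hc (w := fun _ => 1 * ((L : ℝ) ^ j) ^ (d + 1)) (fun _ => hw') ∘ₗ ((((L : ℝ) ^ j) • (onE (LinearMap.funLeft ℝ ℝ (fun b : PBond (⟨d + 1, L, m, K, hd, hL⟩ : Params) 0 => (⟨b.src.unshift lam, b.dir⟩ : PBond (⟨d + 1, L, m, K, hd, hL⟩ : Params) 0))) - LinearMap.id) : BondSpace (⟨d + 1, L, m, K, hd, hL⟩ : Params) →ₗ[ℝ] BondSpace (⟨d + 1, L, m, K, hd, hL⟩ : Params))))))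
    (fun b₀ : PBond (⟨d + 1, L, m, K, hd, hL⟩ : Params) 0 => iterBlockOf j b₀.src) (fun b₀ : PBond (⟨d + 1, L, m, K, hd, hL⟩ : Params) 0 => iterBlockOf j b₀.src) (by positivity : 0 ≤ AH * (Real.exp κH * CD * K₁) * K₂) (le_of_eq (by rw [hK₂])) le_rfl h2
  -- `G̃_j∇* = G∇* − H_j(Q_j(G∇*))`
  have hGt : (tsV1 hc Λ' w).Gt ∘ₗ ((((L : ℝ) ^ j) • (onE (LinearMap.funLeft ℝ ℝ (fun b : PBond (⟨d + 1, L, m, K, hd, hL⟩ : Params) 0 => (⟨b.src.unshift lam, b.dir⟩ : PBond (⟨d + 1, L, m, K, hd, hL⟩ : Params) 0))) - LinearMap.id) : BondSpace (⟨d + 1, L, m, K, hd, hL⟩ : Params) →ₗ[ℝ] BondSpace (⟨d + 1, L, m, K, hd, hL⟩ : Params))) =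
      GE (Domains.whole (P := (⟨d + 1, L, m, K, hd, hL⟩ : Params)) j hj') hc (w := fun _ => 1 * ((L : ℝ) ^ j) ^ (d + 1)) (fun _ => hw') ∘ₗ ((((L : ℝ) ^ j) • (onE (LinearMap.funLeft ℝ ℝ (fun b : PBond (⟨d + 1, L, m, K, hd, hL⟩ : Params) 0 => (⟨b.src.unshift lam, b.dir⟩ : PBond (⟨d + 1, L, m, K, hd, hL⟩ : Params) 0))) - LinearMap.id) : BondSpace (⟨d + 1, L, m, K, hd, hL⟩ : Params) →ₗ[ℝ] BondSpace (⟨d + 1, L, m, K, hd, hL⟩ : Params))) -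
        (tsV1 hc Λ' w).Hj ∘ₗ ((tsV1 hc Λ' w).Qv ∘ₗ (GE (Domains.whole (P := (⟨d + 1, L, m, K, hd, hL⟩ : Params)) j hj') hc (w := fun _ => 1 * ((L : ℝ) ^ j) ^ (d + 1)) (fun _ => hw') ∘ₗ ((((L : ℝ) ^ j) • (onE (LinearMap.funLeft ℝ ℝ (fun b : PBond (⟨d + 1, L, m, K, hd, hL⟩ : Params) 0 => (⟨b.src.unshift lam, b.dir⟩ : PBond (⟨d + 1, L, m, K, hd, hL⟩ : Params) 0))) - LinearMap.id) : BondSpace (⟨d + 1, L, m, K, hd, hL⟩ : Params) →ₗ[ℝ] BondSpace (⟨d + 1, L, m, K, hd, hL⟩ : Params))))) := by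
    rw [Gt_eq_comp_GE hc hj Λ' hw hw', LinearMap.comp_assoc, LinearMap.sub_comp, LinearMap.id_comp, LinearMap.comp_assoc]
  rw [hGt]
  have h5 := blockBound_sub (ρ := (fun t t' : Site (⟨d + 1, L, m, K, hd, hL⟩ : Params) j => torusSupNorm (Mk (⟨d + 1, L, m, K, hd, hL⟩ : Params) j) (rep (Mk (⟨d + 1, L, m, K, hd, hL⟩ : Params) j) t - rep (Mk (⟨d + 1, L, m, K, hd, hL⟩ : Params) j) t'))) _ _
    (fun b₀ : PBond (⟨d + 1, L, m, K, hd, hL⟩ : Params) 0 => iterBlockOf j b₀.src) (fun b₀ : PBond (⟨d + 1, L, m, K, hd, hL⟩ : Params) 0 => iterBlockOf j b₀.src) h3 h4 b₀ y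
  refine h5.trans (le_of_eq ?_)
  rw [hC]


/-! ## §2  The block bound of `G∇_λ*`: Proposition 2.5, the divergence member of (1.110), uniformly -/

open Classical in
/-- **PROPOSITION 2.5, THE DECAY OF `G∇*` FOR THE TWO-SCALE `G` AS A BLOCK BOUND** (at `c = L^j`, weights `a₀n^{d+1} ≤ w ≤ a₁n^{d+1}`): there are
`δ₂ > 0`, `C ≥ 0` depending on `d, L, a₀, a₁` only such that for every volume, `j + 1 ≤ m + K`, `Λ′`, weights in the window, direction `λ`, fine bond
`b₀`, unit site `y`: `Σ_{b₀′ : y(b₀′₋) = y}|(G∇_λ*)(e_{b₀′})_{b₀}| ≤ C·e^{−δ₂|y(b₀₋) − y|_T}` — (2.129) composed with `∇_λ*` on the right,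
`G∇_λ* = K₁∇_λ* + (I − K₂)*[(M∇_λ*) − M(K₂∇_λ*)]`, `M = G̃_j + H_jC̃^{(j)}_ΛH_j*`, `M∇_λ* = G̃_j∇_λ* + H_jC̃(∇_λH_j)*`, with the uniform block bounds of
files 3, 5, 6, 13 and §1 composed by file 2. [cite: Balaban1984PropagatorsII, Prop. 2.5 p.246; Balaban1984PropagatorsI, (1.110) p.35] -/
theorem blockBound_GDadj_scaling (d L : ℕ) (hd : 1 ≤ d + 1) (hL : Odd L ∧ 1 < L) {a₀ a₁ : ℝ} (ha₀ : 0 < a₀) (ha₁ : a₀ ≤ a₁) :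
    ∃ δ : ℝ, 0 < δ ∧ ∃ C : ℝ, 0 ≤ C ∧ ∀ (m K : ℕ) (j : ℕ) (hc : ((L : ℝ) ^ j) ≠ 0)
      (_hj : j + 1 ≤ (⟨d + 1, L, m, K, hd, hL⟩ : Params).m + (⟨d + 1, L, m, K, hd, hL⟩ : Params).K)
      (Λ' : Finset (Site (⟨d + 1, L, m, K, hd, hL⟩ : Params) (j + 1))) (w : CIdx j Λ' → ℝ)
      (_hw0 : ∀ i, a₀ * ((L : ℝ) ^ j) ^ (d + 1) ≤ w i) (_hw1 : ∀ i, w i ≤ a₁ * ((L : ℝ) ^ j) ^ (d + 1)) (lam : Fin (d + 1))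
      (b₀ : PBond (⟨d + 1, L, m, K, hd, hL⟩ : Params) 0) (y : Site (⟨d + 1, L, m, K, hd, hL⟩ : Params) j),
      ∑ b₀' ∈ univ.filter (fun b₀' : PBond (⟨d + 1, L, m, K, hd, hL⟩ : Params) 0 => iterBlockOf j b₀'.src = y),
          |((tsV1 hc Λ' w).G ∘ₗ ((((L : ℝ) ^ j) • (onE (LinearMap.funLeft ℝ ℝ (fun b : PBond (⟨d + 1, L, m, K, hd, hL⟩ : Params) 0 => (⟨b.src.unshift lam, b.dir⟩ : PBond (⟨d + 1, L, m, K, hd, hL⟩ : Params) 0))) - LinearMap.id) : BondSpace (⟨d + 1, L, m, K, hd, hL⟩ : Params) →ₗ[ℝ] BondSpace (⟨d + 1, L, m, K, hd, hL⟩ : Params)))) (EuclideanSpace.single b₀' (1 : ℝ)) b₀| ≤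
        C * Real.exp (-(δ * torusSupNorm (Mk (⟨d + 1, L, m, K, hd, hL⟩ : Params) j)
            (rep (Mk (⟨d + 1, L, m, K, hd, hL⟩ : Params) j) (iterBlockOf j b₀.src) - rep (Mk (⟨d + 1, L, m, K, hd, hL⟩ : Params) j) y))) := by
  obtain ⟨δ₁, hδ₁, C₁, hC₁, hK1D⟩ := blockBound_K1Dadj_scaling d L hd hL
  obtain ⟨δ₂, hδ₂, C₂, hC₂, hK2D⟩ := blockBound_K2Dadj_scaling d L hd hL
  obtain ⟨δ₃, hδ₃, C₃, hC₃, hK2a⟩ := blockBound_K2adj_scaling d L hd hL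
  obtain ⟨δ₄, hδ₄, C₄, hC₄, hHCH⟩ := blockBound_HjCtHj_scaling d L hd hL ha₀ ha₁
  obtain ⟨δ₅, hδ₅, C₅, hC₅, hGt⟩ := blockBound_Gt_scaling d L hd hL
  obtain ⟨δ₆, hδ₆, C₆, hC₆, hHCHD⟩ := blockBound_HjCtDHjadj_scaling d L hd hL ha₀ ha₁
  obtain ⟨δ₇, hδ₇, C₇, hC₇, hGtD⟩ := blockBound_GtDadj_scaling d L hd hL
  -- the common rate and the halvings
  set δ₀ : ℝ := min (min (min δ₁ δ₂) (min δ₃ δ₄)) (min (min δ₅ δ₆) δ₇) with hδ₀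
  have hδ₀0 : 0 < δ₀ := lt_min (lt_min (lt_min hδ₁ hδ₂) (lt_min hδ₃ hδ₄)) (lt_min (lt_min hδ₅ hδ₆) hδ₇)
  have h01 : δ₀ ≤ δ₁ := (min_le_left _ _).trans ((min_le_left _ _).trans (min_le_left _ _))
  have h02 : δ₀ ≤ δ₂ := (min_le_left _ _).trans ((min_le_left _ _).trans (min_le_right _ _))
  have h03 : δ₀ ≤ δ₃ := (min_le_left _ _).trans ((min_le_right _ _).trans (min_le_left _ _))
  have h04 : δ₀ ≤ δ₄ := (min_le_left _ _).trans ((min_le_right _ _).trans (min_le_right _ _))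
  have h05 : δ₀ ≤ δ₅ := (min_le_right _ _).trans ((min_le_left _ _).trans (min_le_left _ _))
  have h06 : δ₀ ≤ δ₆ := (min_le_right _ _).trans ((min_le_left _ _).trans (min_le_right _ _))
  have h07 : δ₀ ≤ δ₇ := (min_le_right _ _).trans (min_le_right _ _)
  set Ka : ℝ := latticeConst (d + 1) (δ₀ - δ₀ / 2) with hKa
  set Kb : ℝ := latticeConst (d + 1) (δ₀ - δ₀ / 4) with hKb
  have hKa0 : 0 ≤ Ka := latticeConst_nonneg _ (by linarith)
  have hKb0 : 0 ≤ Kb := latticeConst_nonneg _ (by linarith)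
  set C : ℝ := C₁ + (1 + C₃) * ((C₇ + C₆) + (C₅ + C₄) * C₂ * Ka) * Kb with hC
  have hC0 : 0 ≤ C := by positivity
  refine ⟨δ₀ / 4, by positivity, C, hC0, ?_⟩
  intro m K j hc hj Λ' w hw0 hw1 lam b₀ y
  have hL0 : 0 < L := by have := hL.2; omega
  have hLp : (0 : ℝ) < L := by exact_mod_cast hL0
  have hw : ∀ i, 0 < w i := fun i => lt_of_lt_of_le (by positivity) (hw0 i)
  have hρ : IsPseudoDist (fun t t' : Site (⟨d + 1, L, m, K, hd, hL⟩ : Params) j => torusSupNorm (Mk (⟨d + 1, L, m, K, hd, hL⟩ : Params) j) (rep (Mk (⟨d + 1, L, m, K, hd, hL⟩ : Params) j) t - rep (Mk (⟨d + 1, L, m, K, hd, hL⟩ : Params) j) t')) :=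
    torusDist_isPseudoDist (Mk (⟨d + 1, L, m, K, hd, hL⟩ : Params) j)
  have hK : SumBound (fun t t' : Site (⟨d + 1, L, m, K, hd, hL⟩ : Params) j => torusSupNorm (Mk (⟨d + 1, L, m, K, hd, hL⟩ : Params) j) (rep (Mk (⟨d + 1, L, m, K, hd, hL⟩ : Params) j) t - rep (Mk (⟨d + 1, L, m, K, hd, hL⟩ : Params) j) t')) (fun a => latticeConst (d + 1) a) :=
    torusDist_sumBound (Mk (⟨d + 1, L, m, K, hd, hL⟩ : Params) j)
  -- (a) the ingredient bounds at the common rate `δ₀`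
  have bK1D := blockBound_mono hρ ((tsV1 hc Λ' w).K1 ∘ₗ ((((L : ℝ) ^ j) • (onE (LinearMap.funLeft ℝ ℝ (fun b : PBond (⟨d + 1, L, m, K, hd, hL⟩ : Params) 0 => (⟨b.src.unshift lam, b.dir⟩ : PBond (⟨d + 1, L, m, K, hd, hL⟩ : Params) 0))) - LinearMap.id) : BondSpace (⟨d + 1, L, m, K, hd, hL⟩ : Params) →ₗ[ℝ] BondSpace (⟨d + 1, L, m, K, hd, hL⟩ : Params)))) (fun b₀ : PBond (⟨d + 1, L, m, K, hd, hL⟩ : Params) 0 => iterBlockOf j b₀.src) (fun b₀ : PBond (⟨d + 1, L, m, K, hd, hL⟩ : Params) 0 => iterBlockOf j b₀.src) hC₁ le_rfl h01 (hK1D m K j hc hj Λ' w hw lam)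
  have bK2D := blockBound_mono hρ ((tsV1 hc Λ' w).K2 ∘ₗ ((((L : ℝ) ^ j) • (onE (LinearMap.funLeft ℝ ℝ (fun b : PBond (⟨d + 1, L, m, K, hd, hL⟩ : Params) 0 => (⟨b.src.unshift lam, b.dir⟩ : PBond (⟨d + 1, L, m, K, hd, hL⟩ : Params) 0))) - LinearMap.id) : BondSpace (⟨d + 1, L, m, K, hd, hL⟩ : Params) →ₗ[ℝ] BondSpace (⟨d + 1, L, m, K, hd, hL⟩ : Params)))) (fun b₀ : PBond (⟨d + 1, L, m, K, hd, hL⟩ : Params) 0 => iterBlockOf j b₀.src) (fun b₀ : PBond (⟨d + 1, L, m, K, hd, hL⟩ : Params) 0 => iterBlockOf j b₀.src) hC₂ le_rfl h02 (hK2D m K j hc hj Λ' w hw lam)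
  have bK2a := blockBound_mono hρ (LinearMap.adjoint (tsV1 hc Λ' w).K2) (fun b₀ : PBond (⟨d + 1, L, m, K, hd, hL⟩ : Params) 0 => iterBlockOf j b₀.src) (fun b₀ : PBond (⟨d + 1, L, m, K, hd, hL⟩ : Params) 0 => iterBlockOf j b₀.src) hC₃ le_rfl h03 (hK2a m K j hc hj Λ' w hw)
  have bHCH := blockBound_mono hρ ((tsV1 hc Λ' w).Hj ∘ₗ (tsV1 hc Λ' w).Ct ∘ₗ LinearMap.adjoint (tsV1 hc Λ' w).Hj) (fun b₀ : PBond (⟨d + 1, L, m, K, hd, hL⟩ : Params) 0 => iterBlockOf j b₀.src) (fun b₀ : PBond (⟨d + 1, L, m, K, hd, hL⟩ : Params) 0 => iterBlockOf j b₀.src) hC₄ le_rfl h04 (hHCH m K j hc hj Λ' w hw0 hw1)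
  have bGt := blockBound_mono hρ (tsV1 hc Λ' w).Gt (fun b₀ : PBond (⟨d + 1, L, m, K, hd, hL⟩ : Params) 0 => iterBlockOf j b₀.src) (fun b₀ : PBond (⟨d + 1, L, m, K, hd, hL⟩ : Params) 0 => iterBlockOf j b₀.src) hC₅ le_rfl h05 (hGt m K j hc hj Λ' w hw)
  have bHCHD := blockBound_mono hρ (((tsV1 hc Λ' w).Hj ∘ₗ (tsV1 hc Λ' w).Ct ∘ₗ LinearMap.adjoint (tsV1 hc Λ' w).Hj) ∘ₗ ((((L : ℝ) ^ j) • (onE (LinearMap.funLeft ℝ ℝ (fun b : PBond (⟨d + 1, L, m, K, hd, hL⟩ : Params) 0 => (⟨b.src.unshift lam, b.dir⟩ : PBond (⟨d + 1, L, m, K, hd, hL⟩ : Params) 0))) - LinearMap.id) : BondSpace (⟨d + 1, L, m, K, hd, hL⟩ : Params) →ₗ[ℝ] BondSpace (⟨d + 1, L, m, K, hd, hL⟩ : Params)))) (fun b₀ : PBond (⟨d + 1, L, m, K, hd, hL⟩ : Params) 0 => iterBlockOf j b₀.src) (fun b₀ : PBond (⟨d + 1, L, m, K, hd, hL⟩ :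 Params) 0 => iterBlockOf j b₀.src) hC₆ le_rfl h06 (hHCHD m K j hc hj Λ' w hw0 hw1 lam)
  have bGtD := blockBound_mono hρ ((tsV1 hc Λ' w).Gt ∘ₗ ((((L : ℝ) ^ j) • (onE (LinearMap.funLeft ℝ ℝ (fun b : PBond (⟨d + 1, L, m, K, hd, hL⟩ : Params) 0 => (⟨b.src.unshift lam, b.dir⟩ : PBond (⟨d + 1, L, m, K, hd, hL⟩ : Params) 0))) - LinearMap.id) : BondSpace (⟨d + 1, L, m, K, hd, hL⟩ : Params) →ₗ[ℝ] BondSpace (⟨d + 1, L, m, K, hd, hL⟩ : Params)))) (fun b₀ : PBond (⟨d + 1, L, m, K, hd, hL⟩ : Params) 0 => iterBlockOf j b₀.src) (fun b₀ : PBond (⟨d + 1, L, m, K, hd, hL⟩ : Params) 0 => iterBlockOf j b₀.src) hC₇ le_rfl h07 (hGtD m K j hc hj Λ' w hw lam)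
  have bid := blockBound_id hρ (fun b₀ : PBond (⟨d + 1, L, m, K, hd, hL⟩ : Params) 0 => iterBlockOf j b₀.src) δ₀
  -- (b) `I − K₂*`, `M = G̃_j + H_jC̃H_j*`, `M∇* = G̃_j∇* + H_jC̃H_j*∇*`, `M(K₂∇*)`
  have bIK2a := blockBound_sub (ρ := (fun t t' : Site (⟨d + 1, L, m, K, hd, hL⟩ : Params) j => torusSupNorm (Mk (⟨d + 1, L, m, K, hd, hL⟩ : Params) j) (rep (Mk (⟨d + 1, L, m, K, hd, hL⟩ : Params) j) t - rep (Mk (⟨d + 1, L, m, K, hd, hL⟩ : Params) j) t'))) _ _ (fun b₀ : PBond (⟨d + 1, L, m, K, hd, hL⟩ : Params) 0 => iterBlockOf j b₀.src) (fun b₀ : PBond (⟨d + 1, L, m, K, hd, hL⟩ : Params) 0 => iterBlockOf j b₀.src) bid bK2a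
  have bM := blockBound_add (ρ := (fun t t' : Site (⟨d + 1, L, m, K, hd, hL⟩ : Params) j => torusSupNorm (Mk (⟨d + 1, L, m, K, hd, hL⟩ : Params) j) (rep (Mk (⟨d + 1, L, m, K, hd, hL⟩ : Params) j) t - rep (Mk (⟨d + 1, L, m, K, hd, hL⟩ : Params) j) t'))) _ _ (fun b₀ : PBond (⟨d + 1, L, m, K, hd, hL⟩ : Params) 0 => iterBlockOf j b₀.src) (fun b₀ : PBond (⟨d + 1, L, m, K, hd, hL⟩ : Params) 0 => iterBlockOf j b₀.src) bGt bHCH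
  have bMD := blockBound_add (ρ := (fun t t' : Site (⟨d + 1, L, m, K, hd, hL⟩ : Params) j => torusSupNorm (Mk (⟨d + 1, L, m, K, hd, hL⟩ : Params) j) (rep (Mk (⟨d + 1, L, m, K, hd, hL⟩ : Params) j) t - rep (Mk (⟨d + 1, L, m, K, hd, hL⟩ : Params) j) t'))) _ _ (fun b₀ : PBond (⟨d + 1, L, m, K, hd, hL⟩ : Params) 0 => iterBlockOf j b₀.src) (fun b₀ : PBond (⟨d + 1, L, m, K, hd, hL⟩ : Params) 0 => iterBlockOf j b₀.src) bGtD bHCHD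
  have bMK2D := blockBound_comp hρ hK ((tsV1 hc Λ' w).Gt + (tsV1 hc Λ' w).Hj ∘ₗ (tsV1 hc Λ' w).Ct ∘ₗ LinearMap.adjoint (tsV1 hc Λ' w).Hj) ((tsV1 hc Λ' w).K2 ∘ₗ ((((L : ℝ) ^ j) • (onE (LinearMap.funLeft ℝ ℝ (fun b : PBond (⟨d + 1, L, m, K, hd, hL⟩ : Params) 0 => (⟨b.src.unshift lam, b.dir⟩ : PBond (⟨d + 1, L, m, K, hd, hL⟩ : Params) 0))) - LinearMap.id) : BondSpace (⟨d + 1, L, m, K, hd, hL⟩ : Params) →ₗ[ℝ] BondSpace (⟨d + 1, L, m, K, hd, hL⟩ : Params)))) (fun b₀ : PBond (⟨d + 1, L, m, K, hd, hL⟩ : Params) 0 => iterBlockOf j b₀.src) (fun b₀ : PBond (⟨d + 1, L, m, K, hd, hL⟩ : Params) 0 => iterBlockOf j b₀.src) (fun b₀ : PBond (⟨d + 1, L, m, K, hd, hL⟩ : Params) 0 => iterBlockOf j b₀.src)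
    (Cf := C₅ + C₄) (Cg := C₂) (by positivity) hC₂
    (show (0 : ℝ) ≤ δ₀ / 2 by positivity) (show δ₀ / 2 ≤ δ₀ by linarith) (show δ₀ / 2 < δ₀ by linarith) bM bK2D
  have bMD' := blockBound_mono hρ ((tsV1 hc Λ' w).Gt ∘ₗ ((((L : ℝ) ^ j) • (onE (LinearMap.funLeft ℝ ℝ (fun b : PBond (⟨d + 1, L, m, K, hd, hL⟩ : Params) 0 => (⟨b.src.unshift lam, b.dir⟩ : PBond (⟨d + 1, L, m, K, hd, hL⟩ : Params) 0))) - LinearMap.id) : BondSpace (⟨d + 1, L, m, K, hd, hL⟩ : Params) →ₗ[ℝ] BondSpace (⟨d + 1, L, m, K, hd, hL⟩ : Params))) + ((tsV1 hc Λ' w).Hj ∘ₗ (tsV1 hc Λ' w).Ct ∘ₗ LinearMap.adjoint (tsV1 hc Λ' w).Hj) ∘ₗ ((((L : ℝ) ^ j) • (onE (LinearMap.funLeft ℝ ℝ (fun b : PBond (⟨d + 1, L, m, K, hd, hL⟩ : Params) 0 => (⟨b.src.unshift lam, b.dir⟩ : PBond (⟨d + 1, L, m, K, hd, hL⟩ :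 Params) 0))) - LinearMap.id) : BondSpace (⟨d + 1, L, m, K, hd, hL⟩ : Params) →ₗ[ℝ] BondSpace (⟨d + 1, L, m, K, hd, hL⟩ : Params)))) (fun b₀ : PBond (⟨d + 1, L, m, K, hd, hL⟩ : Params) 0 => iterBlockOf j b₀.src) (fun b₀ : PBond (⟨d + 1, L, m, K, hd, hL⟩ : Params) 0 => iterBlockOf j b₀.src)
    (by positivity : (0 : ℝ) ≤ C₇ + C₆) le_rfl (show δ₀ / 2 ≤ δ₀ by linarith) bMD
  have bInner := blockBound_sub (ρ := (fun t t' : Site (⟨d + 1, L, m, K, hd, hL⟩ : Params) j => torusSupNorm (Mk (⟨d + 1, L, m, K, hd, hL⟩ : Params) j) (rep (Mk (⟨d + 1, L, m, K, hd, hL⟩ : Params) j) t - rep (Mk (⟨d + 1, L, m, K, hd, hL⟩ : Params) j) t'))) _ _ (fun b₀ : PBond (⟨d + 1, L, m, K, hd, hL⟩ : Params) 0 => iterBlockOf j b₀.src) (fun b₀ : PBond (⟨d + 1, L, m, K, hd, hL⟩ : Params) 0 => iterBlockOf j b₀.src) bMD' bMK2D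
  -- (c) `(I − K₂*)·[M∇* − M(K₂∇*)]` at rate `δ₀/4`, and the sum with `K₁∇*`
  have bOuter := blockBound_comp hρ hK (LinearMap.id - LinearMap.adjoint (tsV1 hc Λ' w).K2)
    (((tsV1 hc Λ' w).Gt ∘ₗ ((((L : ℝ) ^ j) • (onE (LinearMap.funLeft ℝ ℝ (fun b : PBond (⟨d + 1, L, m, K, hd, hL⟩ : Params) 0 => (⟨b.src.unshift lam, b.dir⟩ : PBond (⟨d + 1, L, m, K, hd, hL⟩ : Params) 0))) - LinearMap.id) : BondSpace (⟨d + 1, L, m, K, hd, hL⟩ : Params) →ₗ[ℝ] BondSpace (⟨d + 1, L, m, K, hd, hL⟩ : Params))) + ((tsV1 hc Λ' w).Hj ∘ₗ (tsV1 hc Λ' w).Ct ∘ₗ LinearMap.adjoint (tsV1 hc Λ' w).Hj) ∘ₗ ((((L : ℝ) ^ j) • (onE (LinearMap.funLeft ℝ ℝ (fun b : PBond (⟨d + 1, L, m, K, hd, hL⟩ : Params) 0 => (⟨b.src.unshift lam, b.dir⟩ : PBond (⟨d + 1, L, m, K, hd, hL⟩ : Params) 0))) - LinearMap.id) : BondSpace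 (⟨d + 1, L, m, K, hd, hL⟩ : Params) →ₗ[ℝ] BondSpace (⟨d + 1, L, m, K, hd, hL⟩ : Params)))) - ((tsV1 hc Λ' w).Gt + (tsV1 hc Λ' w).Hj ∘ₗ (tsV1 hc Λ' w).Ct ∘ₗ LinearMap.adjoint (tsV1 hc Λ' w).Hj) ∘ₗ ((tsV1 hc Λ' w).K2 ∘ₗ ((((L : ℝ) ^ j) • (onE (LinearMap.funLeft ℝ ℝ (fun b : PBond (⟨d + 1, L, m, K, hd, hL⟩ : Params) 0 => (⟨b.src.unshift lam, b.dir⟩ : PBond (⟨d + 1, L, m, K, hd, hL⟩ : Params) 0))) - LinearMap.id) : BondSpace (⟨d + 1, L, m, K, hd, hL⟩ : Params) →ₗ[ℝ] BondSpace (⟨d + 1, L, m, K, hd, hL⟩ : Params))))) (fun b₀ : PBond (⟨d + 1, L, m, K, hd, hL⟩ : Params) 0 => iterBlockOf j b₀.src) (fun b₀ : PBond (⟨d + 1, L, m, K, hd, hL⟩ : Params) 0 => iterBlockOf j b₀.src) (fun b₀ : PBond (⟨d + 1, L, m, K, hd, hL⟩ : Params) 0 => iterBlockOf j b₀.src)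
    (Cf := 1 + C₃) (Cg := (C₇ + C₆) + (C₅ + C₄) * C₂ * Ka) (by positivity) (by positivity)
    (show (0 : ℝ) ≤ δ₀ / 4 by positivity) (show δ₀ / 4 ≤ δ₀ / 2 by linarith) (show δ₀ / 4 < δ₀ by linarith) bIK2a
    (fun i y => (bInner i y).trans (le_of_eq (by rw [hKa])))
  have bK1D' := blockBound_mono hρ ((tsV1 hc Λ' w).K1 ∘ₗ ((((L : ℝ) ^ j) • (onE (LinearMap.funLeft ℝ ℝ (fun b : PBond (⟨d + 1, L, m, K, hd, hL⟩ : Params) 0 => (⟨b.src.unshift lam, b.dir⟩ : PBond (⟨d + 1, L, m, K, hd, hL⟩ : Params) 0))) - LinearMap.id) : BondSpace (⟨d + 1, L, m, K, hd, hL⟩ : Params) →ₗ[ℝ] BondSpace (⟨d + 1, L, m, K, hd, hL⟩ : Params)))) (fun b₀ : PBond (⟨d + 1, L, m, K, hd, hL⟩ : Params) 0 => iterBlockOf j b₀.src) (fun b₀ : PBond (⟨d + 1, L, m, K, hd, hL⟩ : Params) 0 => iterBlockOf j b₀.src) hC₁ le_rfl (show δ₀ / 4 ≤ δ₀ by linarith)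 bK1D
  have btot := blockBound_add (ρ := (fun t t' : Site (⟨d + 1, L, m, K, hd, hL⟩ : Params) j => torusSupNorm (Mk (⟨d + 1, L, m, K, hd, hL⟩ : Params) j) (rep (Mk (⟨d + 1, L, m, K, hd, hL⟩ : Params) j) t - rep (Mk (⟨d + 1, L, m, K, hd, hL⟩ : Params) j) t'))) _ _ (fun b₀ : PBond (⟨d + 1, L, m, K, hd, hL⟩ : Params) 0 => iterBlockOf j b₀.src) (fun b₀ : PBond (⟨d + 1, L, m, K, hd, hL⟩ : Params) 0 => iterBlockOf j b₀.src) bK1D' bOuter b₀ y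
  -- (d) the algebra: `G∇* = K₁∇* + (I − K₂*)((G̃_j∇* + H_jC̃H_j*∇*) − M(K₂∇*))`
  have hadj : LinearMap.adjoint (LinearMap.id - (tsV1 hc Λ' w).K2) = LinearMap.id - LinearMap.adjoint (tsV1 hc Λ' w).K2 := by
    rw [map_sub, LinearMap.adjoint_id]
  have hGD : (tsV1 hc Λ' w).G ∘ₗ ((((L : ℝ) ^ j) • (onE (LinearMap.funLeft ℝ ℝ (fun b : PBond (⟨d + 1, L, m, K, hd, hL⟩ : Params) 0 => (⟨b.src.unshift lam, b.dir⟩ : PBond (⟨d + 1, L, m, K, hd, hL⟩ : Params) 0))) - LinearMap.id) : BondSpace (⟨d + 1, L, m, K, hd, hL⟩ : Params) →ₗ[ℝ] BondSpace (⟨d + 1, L, m, K, hd, hL⟩ : Params))) =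
      (tsV1 hc Λ' w).K1 ∘ₗ ((((L : ℝ) ^ j) • (onE (LinearMap.funLeft ℝ ℝ (fun b : PBond (⟨d + 1, L, m, K, hd, hL⟩ : Params) 0 => (⟨b.src.unshift lam, b.dir⟩ : PBond (⟨d + 1, L, m, K, hd, hL⟩ : Params) 0))) - LinearMap.id) : BondSpace (⟨d + 1, L, m, K, hd, hL⟩ : Params) →ₗ[ℝ] BondSpace (⟨d + 1, L, m, K, hd, hL⟩ : Params))) +
        (LinearMap.id - LinearMap.adjoint (tsV1 hc Λ' w).K2) ∘ₗ
          (((tsV1 hc Λ' w).Gt ∘ₗ ((((L : ℝ) ^ j) • (onE (LinearMap.funLeft ℝ ℝ (fun b : PBond (⟨d + 1, L, m, K, hd, hL⟩ : Params) 0 => (⟨b.src.unshift lam, b.dir⟩ : PBond (⟨d + 1, L, m, K, hd, hL⟩ : Params) 0))) - LinearMap.id) : BondSpace (⟨d + 1, L, m, K, hd, hL⟩ : Params) →ₗ[ℝ] BondSpace (⟨d + 1, L, m, K, hd, hL⟩ : Params))) + ((tsV1 hc Λ' w).Hj ∘ₗ (tsV1 hc Λ' w).Ct ∘ₗ LinearMap.adjoint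 (tsV1 hc Λ' w).Hj) ∘ₗ ((((L : ℝ) ^ j) • (onE (LinearMap.funLeft ℝ ℝ (fun b : PBond (⟨d + 1, L, m, K, hd, hL⟩ : Params) 0 => (⟨b.src.unshift lam, b.dir⟩ : PBond (⟨d + 1, L, m, K, hd, hL⟩ : Params) 0))) - LinearMap.id) : BondSpace (⟨d + 1, L, m, K, hd, hL⟩ : Params) →ₗ[ℝ] BondSpace (⟨d + 1, L, m, K, hd, hL⟩ : Params)))) - ((tsV1 hc Λ' w).Gt + (tsV1 hc Λ' w).Hj ∘ₗ (tsV1 hc Λ' w).Ct ∘ₗ LinearMap.adjoint (tsV1 hc Λ' w).Hj) ∘ₗ ((tsV1 hc Λ' w).K2 ∘ₗ ((((L : ℝ) ^ j) • (onE (LinearMap.funLeft ℝ ℝ (fun b : PBond (⟨d + 1, L, m, K, hd, hL⟩ : Params) 0 => (⟨b.src.unshift lam, b.dir⟩ : PBond (⟨d + 1, L, m, K, hd, hL⟩ : Params) 0))) - LinearMap.id) : BondSpace (⟨d + 1, L, m, K, hd, hL⟩ : Params) →ₗ[ℝ] BondSpace (⟨d + 1, L, m, K, hd, hL⟩ : Params)))))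 := by
    rw [G_eq_op_V1 hc hj Λ' hw, hadj]
    refine LinearMap.ext fun v => ?_
    simp only [LinearMap.comp_apply, LinearMap.add_apply, LinearMap.sub_apply, LinearMap.id_apply, map_add, map_sub]
  rw [hGD]
  refine btot.trans (le_of_eq ?_)
  rw [hC, hKb]

/-! ## §3  The printed shape: `|(G∇*J)(x)| ≤ O(1)e^{−δ₂|y − y′|}|J|` -/

open Classical in
/-- **PROPOSITION 2.5, THE MEMBER `|(G∇*J)(x)|` OF (1.110) IN THE PRINTED SHAPE** for the genuine two-scale `G` of (2.90), `Λ′` arbitrary (at `c = L^j`,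
weights `a₀n^{d+1} ≤ w ≤ a₁n^{d+1}`), component `λ` of the divergence: there are `δ₂ > 0`, `C ≥ 0` depending on `d, L, a₀, a₁` only such that for
every volume, `j + 1 ≤ m + K`, `Λ′`, weights in the window, direction `λ`, radius `r ≥ 0`, every fine bond field `J` supported on the fine bonds
over the unit sites within `r` of `y′` with `|J| ≤ X`, and every fine bond `b₀` over the unit sites within `r` of `y`:
`|(G(∇_λ*J))(b₀)| ≤ C·e^{(1+2δ₂)r}·e^{−δ₂|y − y′|_T}·X`, `(∇_λ*J)(b) = n·(J(b − e_λ) − J(b))`.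
[cite: Balaban1984PropagatorsII, Prop. 2.5 p.246; Balaban1984PropagatorsI, (1.110) p.35] -/
theorem prop25_ineq110_Gdiv (d L : ℕ) (hd : 1 ≤ d + 1) (hL : Odd L ∧ 1 < L) {a₀ a₁ : ℝ} (ha₀ : 0 < a₀) (ha₁ : a₀ ≤ a₁) :
    ∃ δ : ℝ, 0 < δ ∧ ∃ C : ℝ, 0 ≤ C ∧ ∀ (m K : ℕ) (j : ℕ) (hc : ((L : ℝ) ^ j) ≠ 0)
      (_hj : j + 1 ≤ (⟨d + 1, L, m, K, hd, hL⟩ : Params).m + (⟨d + 1, L, m, K, hd, hL⟩ : Params).K)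
      (Λ' : Finset (Site (⟨d + 1, L, m, K, hd, hL⟩ : Params) (j + 1))) (w : CIdx j Λ' → ℝ)
      (_hw0 : ∀ i, a₀ * ((L : ℝ) ^ j) ^ (d + 1) ≤ w i) (_hw1 : ∀ i, w i ≤ a₁ * ((L : ℝ) ^ j) ^ (d + 1)) (lam : Fin (d + 1))
      (r : ℝ) (_hr : 0 ≤ r) (J : BondSpace (⟨d + 1, L, m, K, hd, hL⟩ : Params)) (X : ℝ) (_hX : 0 ≤ X)
      (y y' : Site (⟨d + 1, L, m, K, hd, hL⟩ : Params) j)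
      (_hsupp : ∀ b : PBond (⟨d + 1, L, m, K, hd, hL⟩ : Params) 0, J b ≠ 0 →
        torusSupNorm (Mk (⟨d + 1, L, m, K, hd, hL⟩ : Params) j) (rep (Mk (⟨d + 1, L, m, K, hd, hL⟩ : Params) j) (iterBlockOf j b.src) - rep (Mk (⟨d + 1, L, m, K, hd, hL⟩ : Params) j) y') ≤ r)
      (_hJ : ∀ b : PBond (⟨d + 1, L, m, K, hd, hL⟩ : Params) 0, |J b| ≤ X)
      (b₀ : PBond (⟨d + 1, L, m, K, hd, hL⟩ : Params) 0)
      (_hb₀ : torusSupNorm (Mk (⟨d + 1, L, m, K, hd, hL⟩ : Params) j) (rep (Mk (⟨d + 1, L, m, K, hd, hL⟩ : Params) j) (iterBlockOf j b₀.src) - rep (Mk (⟨d + 1, L, m, K, hd, hL⟩ : Params) j) y) ≤ r),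
      |(tsV1 hc Λ' w).G (((((L : ℝ) ^ j) • (onE (LinearMap.funLeft ℝ ℝ (fun b : PBond (⟨d + 1, L, m, K, hd, hL⟩ : Params) 0 => (⟨b.src.unshift lam, b.dir⟩ : PBond (⟨d + 1, L, m, K, hd, hL⟩ : Params) 0))) - LinearMap.id) : BondSpace (⟨d + 1, L, m, K, hd, hL⟩ : Params) →ₗ[ℝ] BondSpace (⟨d + 1, L, m, K, hd, hL⟩ : Params))) J) b₀| ≤
        C * Real.exp ((1 + 2 * δ) * r) * Real.exp (-(δ * torusSupNorm (Mk (⟨d + 1, L, m, K, hd, hL⟩ : Params) j)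
          (rep (Mk (⟨d + 1, L, m, K, hd, hL⟩ : Params) j) y - rep (Mk (⟨d + 1, L, m, K, hd, hL⟩ : Params) j) y'))) * X := by
  obtain ⟨δ, hδ, C, hC, h⟩ := blockBound_GDadj_scaling d L hd hL ha₀ ha₁
  refine ⟨δ, hδ, C * latticeConst (d + 1) 1, mul_nonneg hC (latticeConst_nonneg _ zero_le_one), ?_⟩
  intro m K j hc hj Λ' w hw0 hw1 lam r hr J X hX y y' hsupp hJ b₀ hb₀
  have hρ : IsPseudoDist (fun t t' : Site (⟨d + 1, L, m, K, hd, hL⟩ : Params) j => torusSupNorm (Mk (⟨d + 1, L, m, K, hd, hL⟩ : Params) j) (rep (Mk (⟨d + 1, L, m, K, hd, hL⟩ : Params) j) t - rep (Mk (⟨d + 1, L, m, K, hd, hL⟩ : Params) j) t')) :=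
    torusDist_isPseudoDist (Mk (⟨d + 1, L, m, K, hd, hL⟩ : Params) j)
  have hK : SumBound (fun t t' : Site (⟨d + 1, L, m, K, hd, hL⟩ : Params) j => torusSupNorm (Mk (⟨d + 1, L, m, K, hd, hL⟩ : Params) j) (rep (Mk (⟨d + 1, L, m, K, hd, hL⟩ : Params) j) t - rep (Mk (⟨d + 1, L, m, K, hd, hL⟩ : Params) j) t')) (fun a => latticeConst (d + 1) a) :=
    torusDist_sumBound (Mk (⟨d + 1, L, m, K, hd, hL⟩ : Params) j)
  have h' := abs_apply_le_of_support hρ hK ((tsV1 hc Λ' w).G ∘ₗ ((((L : ℝ) ^ j) • (onE (LinearMap.funLeft ℝ ℝ (fun b : PBond (⟨d + 1, L, m, K, hd, hL⟩ : Params) 0 => (⟨b.src.unshift lam, b.dir⟩ : PBond (⟨d + 1, L, m, K, hd, hL⟩ : Params) 0))) - LinearMap.id) : BondSpace (⟨d + 1, L, m, K, hd, hL⟩ : Params) →ₗ[ℝ] BondSpace (⟨d + 1, L, m, K, hd, hL⟩ : Params)))) (fun b₀ : PBond (⟨d + 1, L, m, K, hd, hL⟩ : Params) 0 => iterBlockOf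 j b₀.src) (fun b₀ : PBond (⟨d + 1, L, m, K, hd, hL⟩ : Params) 0 => iterBlockOf j b₀.src) hC hδ.le hX
    (h m K j hc hj Λ' w hw0 hw1 lam) J y y' hsupp hJ b₀ hb₀
  rw [LinearMap.comp_apply] at h'
  refine h'.trans (le_of_eq ?_)
  ring

end Literature.MathematicalPhysics.QuantumFieldTheory.Balaban1983to89.B6Prop25GDivDecayTwoScaleV1

end
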